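import Literature.AnabelianGeometry.EtaleTheta.Discharge.Sec2KLConjugacyProofs
import Literature.AnabelianGeometry.EtaleTheta.Discharge.Sec2TowerLemmas
import HarnessLib

/-!
# [EtTh] Prop 2.14 (ii) ⟺ extension of the Galois difference cocycles (proof-only companion)

Mochizuki, *The Étale Theta Function …* [EtTh], Publ. RIMS 45 (2009), §2, Prop. 2.14 (ii), PRIMS
text pp.49–51 (locators `p.N` = PDF pages; bib key `MochizukiEtTh2009`): "the difference
`s^Θ_Ÿ − t^Θ_Ÿ` … determines a [continuous] cocycle `Π^tp_Ÿ → μ_N` which extends to `Π^tp_Y`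
[since `Ü²` descends to `Y`]; the resulting shift `α_δ ∈ Aut(Π^tp_Y[μ_N])` … preserves `D_Y`".

PROOF-ONLY companion of `ThetaRigidity.lean` (seat abc-iut-L2-t2; FROZEN FACT-LIST row F-0632
`RigidData.Prop214_ii`), written by the cell `abc-iut` (seat abc-iut-f-149, F-TRANCHES 149 of
D-0078 (S1)). Over the lawless interface `R : RigidData N l` the named fact `Prop214_ii` is a SCHEMA;
this file pins down its EXACT content for every `R`:

* `RigidData.gal_extension_of_prop214_ii`, `RigidData.prop214_ii_iff_gal_extension` —
  **`R.Prop214_ii` ⟺ for every theta cocycle `η` and every `x ∈ Π^tp_X`, the Galois difference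
  cocycle `g ↦ η(g) · (χ(x) η(x⁻¹ g x))⁻¹` on `Π^tp_Ÿ` extends to a cocycle `ρ` of `Π^tp_Y` whose shift
  `α_ρ` is bi-continuous and normalises `D_Y`** (`→`: apply `Prop214_ii` to the `Gal`-conjugate
  `t^Θ := conj_x ∘ s^Θ_η ∘ conj_x⁻¹`; `←`: abc-iut-L2-t10's `prop214_ii_of_gal_extension`,
  `Discharge/Sec2KLConjugacyProofs.lean`).
* `RigidData.gal_extension_of_mem_PiYdd` — the condition is AUTOMATIC for `x ∈ Π^tp_Ÿ` (the difference
  is the coboundary of `η(x)`, whose shift is `μ_N`-conjugation, trivial in `Out`).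
* `RigidData.gal_extension_mul`, `RigidData.gal_extension_inv` — the set of `x` satisfying the
  condition is closed under products and inverses (`(xy)·η`-difference `= (x·η)`-difference times the
  `x`-conjugate of the `(y·η)`-difference).
* `RigidData.prop214_ii_of_gal_extension_generators` — hence **`Prop214_ii` follows from the extension
  condition on any subset `S ⊆ Π^tp_X` with `⟨S⟩ · Π^tp_Ÿ = Π^tp_X`** (e.g. one lift of a generator of
  `Gal(Y/X) ≅ l·ℤ` and one of `Gal(Ÿ/Y) ≅ μ₂`: `Π^tp_X/Π^tp_Ÿ ≅ (l·ℤ) × μ₂`, p.41).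

HONEST FRAMING: pure group theory over the interface; the condition FAILS at some inhabitants of the
interface (the universally closed row is false) and HOLDS at the lane-C2 model
(`DoubleUnderline.rigidData_prop214_ii`, `Discharge/Sec2Prop214iiOfSetting.lean`). Nothing of [EtTh]
(refereed) is asserted or denied; no side taken on [IUTchIII] Cor. 3.12; typed ≠ proved. No
definitions, no instances.
-/

namespace Literature.AnabelianGeometry.EtaleTheta

universe u

namespace RigidData

variable {N : ℕ+} {l : ℕ} (R : RigidData.{u} N l)

/-! ## §1. `Prop214_ii` ⟺ the Galois difference cocycles extend -/

/-- **`Prop214_ii` ⟹ extension**: applying Prop. 2.14 (ii) to the `Gal`-conjugate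
`t^Θ = conj_x ∘ s^Θ_η ∘ conj_{x⁻¹}` of `s^Θ_η` yields a cocycle `ρ` of `Π^tp_Y`, with bi-continuous
`D_Y`-normalising shift, which on `Π^tp_Ÿ` IS the Galois difference cocycle
`g ↦ η(g)·(χ(x) η(x⁻¹ g x))⁻¹`. [cite: MochizukiEtTh2009, Prop 2.14(ii) p.49] -/
theorem gal_extension_of_prop214_ii (h : R.Prop214_ii) (η : R.PiYdd → R.mu)
    (hη : η ∈ R.thetaCocycles) (x : R.PiX) :
    ∃ (ρ : R.PiY → R.mu) (hρ : CycEnvelope.IsEnvCocycle R.augY R.chi ρ)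
      (hc : CycEnvelope.shift hρ ∈ contMulAut R.env),
      (∀ g : R.PiYdd, ρ (R.inclYdd g) = η g * (R.chi (R.aug x) (η ⟨x⁻¹ * g * x, by
        simpa [mul_assoc] using R.PiYdd_normal.conj_mem _ g.2 x⁻¹⟩))⁻¹) ∧
      R.DY.map (MulAut.conj (TopOut.mk _ ⟨_, hc⟩)).toMonoidHom = R.DY := by
  obtain ⟨δ, hδ, hc, hs, hD⟩ := h η hη _
    (ThetaEnvData.IsKLConjugate.gal _ x ThetaEnvData.IsKLConjugate.base)
  refine ⟨δ, hδ, hc, fun g => ?_, hD⟩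
  have hl := congrArg SemidirectProduct.left (hs g)
  simp only [CycEnvelope.shift_apply, ThetaEnvData.sTheta, MonoidHom.coe_mk, OneHom.coe_mk,
    ThetaEnvData.conjX, MulEquiv.coe_mk, Equiv.coe_fn_mk, map_inv] at hl
  rw [inv_mul_eq_iff_eq_mul] at hl
  exact hl

/-- **[EtTh] Prop. 2.14 (ii) ⟺ the Galois difference cocycles extend** (exact content of the schema
row F-0632 over every `RigidData`): `Prop214_ii` holds iff for every theta cocycle `η` and every
`x ∈ Π^tp_X` the cocycle `g ↦ η(g)·(χ(x) η(x⁻¹ g x))⁻¹` of `Π^tp_Ÿ` extends to a cocycle of `Π^tp_Y`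
with bi-continuous, `D_Y`-normalising shift. [cite: MochizukiEtTh2009, Prop 2.14(ii) p.49] -/
theorem prop214_ii_iff_gal_extension :
    R.Prop214_ii ↔ ∀ (η : R.PiYdd → R.mu) (_ : η ∈ R.thetaCocycles) (x : R.PiX),
      ∃ (ρ : R.PiY → R.mu) (hρ : CycEnvelope.IsEnvCocycle R.augY R.chi ρ)
        (hc : CycEnvelope.shift hρ ∈ contMulAut R.env),
        (∀ g : R.PiYdd, ρ (R.inclYdd g) = η g * (R.chi (R.aug x) (η ⟨x⁻¹ * g * x, by
          simpa [mul_assoc] using R.PiYdd_normal.conj_mem _ g.2 x⁻¹⟩))⁻¹) ∧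
        R.DY.map (MulAut.conj (TopOut.mk _ ⟨_, hc⟩)).toMonoidHom = R.DY :=
  ⟨fun h η hη x => R.gal_extension_of_prop214_ii h η hη x,
    fun h => R.prop214_ii_of_gal_extension h⟩

/-! ## §2. The extension condition is automatic on `Π^tp_Ÿ` -/

/-- For `x ∈ Π^tp_Ÿ` the Galois difference cocycle is the restriction of the COBOUNDARY of `η(x)`:
`η(g)·(χ(x) η(x⁻¹ g x))⁻¹ = η(x)·(χ(g) η(x))⁻¹` (cocycle identity).
[cite: MochizukiEtTh2009, Prop 2.14(ii) p.49] -/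
theorem galDiff_eq_coboundary_of_mem {η : R.PiYdd → R.mu} (hη : η ∈ R.thetaCocycles)
    {x : R.PiX} (hx : x ∈ R.PiYdd) (g : R.PiYdd) :
    η g * (R.chi (R.aug x) (η ⟨x⁻¹ * g * x, by
        simpa [mul_assoc] using R.PiYdd_normal.conj_mem _ g.2 x⁻¹⟩))⁻¹ =
      CycEnvelope.coboundary R.augY R.chi (η ⟨x, hx⟩) (R.inclYdd g) := by
  have hc := R.isCocycle η hη
  -- `χ(x) η(x⁻¹ g x) = η(x)⁻¹ · η(g) · χ(g) η(x)` (cocycle identity on `x⁻¹ · g · x`)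
  have key : R.chi (R.aug x) (η ⟨x⁻¹ * g * x, by
        simpa [mul_assoc] using R.PiYdd_normal.conj_mem _ g.2 x⁻¹⟩) =
      (η ⟨x, hx⟩)⁻¹ * η g * R.chi (R.aug (g : R.PiX)) (η ⟨x, hx⟩) := by
    have hmem : (⟨x⁻¹ * g * x, by simpa [mul_assoc] using R.PiYdd_normal.conj_mem _ g.2 x⁻¹⟩ :
        R.PiYdd) = ⟨x, hx⟩⁻¹ * g * ⟨x, hx⟩ := rfl
    have h1 : η 1 = 1 := CycEnvelope.IsEnvCocycle.apply_one hc
    have hxinv : R.chi (R.aug x) (η ⟨x, hx⟩⁻¹) = (η ⟨x, hx⟩)⁻¹ := by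
      have h := hc ⟨x, hx⟩⁻¹ ⟨x, hx⟩
      rw [inv_mul_cancel, h1] at h
      have h' : η ⟨x, hx⟩⁻¹ = (R.chi (R.aug x⁻¹) (η ⟨x, hx⟩))⁻¹ :=
        eq_inv_of_mul_eq_one_left h.symm
      rw [h', map_inv (R.chi (R.aug x)), ← MulAut.mul_apply, ← map_mul, ← map_mul, mul_inv_cancel,
        map_one, map_one, MulAut.one_apply]
    have e1 : R.aug x * (R.aug.comp R.PiYdd.subtype) ⟨x, hx⟩⁻¹ = 1 := by
      change R.aug x * R.aug x⁻¹ = 1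
      rw [map_inv, mul_inv_cancel]
    have e2 : R.aug x * (R.aug.comp R.PiYdd.subtype) (⟨x, hx⟩⁻¹ * g) = R.aug (g : R.PiX) := by
      change R.aug x * R.aug (x⁻¹ * g) = R.aug g
      rw [map_mul, map_inv, mul_inv_cancel_left]
    rw [hmem, hc, hc, map_mul, map_mul, hxinv, ← MulAut.mul_apply, ← map_mul, e1, map_one,
      MulAut.one_apply, ← MulAut.mul_apply, ← map_mul, e2]
  rw [key, mul_inv_rev, mul_inv_rev, inv_inv]
  change η g * (((R.chi (R.aug (g : R.PiX))) (η ⟨x, hx⟩))⁻¹ * ((η g)⁻¹ * η ⟨x, hx⟩)) =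
    η ⟨x, hx⟩ * ((R.chi (R.aug (g : R.PiX))) (η ⟨x, hx⟩))⁻¹
  rw [mul_left_comm (η g), mul_inv_cancel_left, mul_comm]

/-- The shift by a coboundary is `μ_N`-conjugation. [cite: MochizukiEtTh2009, Prop 2.14(ii) p.47] -/
theorem shift_coboundary_eq_conj (c : R.mu) :
    CycEnvelope.shift (CycEnvelope.isEnvCocycle_coboundary R.augY R.chi c) =
      MulAut.conj (CycEnvelope.inMu R.augY R.chi c) :=
  MulEquiv.ext fun y => (CycEnvelope.conj_inMu_eq_shift_coboundary R.augY R.chi c y).symm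

/-- The shift by a coboundary is bi-continuous. [cite: MochizukiEtTh2009, Prop 2.14(ii) p.47] -/
theorem shift_coboundary_mem_contMulAut (c : R.mu) :
    CycEnvelope.shift (CycEnvelope.isEnvCocycle_coboundary R.augY R.chi c) ∈ contMulAut R.env := by
  rw [R.shift_coboundary_eq_conj c]
  exact R.toThetaEnvData.conj_inMu_mem_contMulAut c

/-- The class in `Out(Π^tp_Y[μ_N])` of the shift by a coboundary is trivial (it is inner).
[cite: MochizukiEtTh2009, Prop 2.14(ii) p.47] -/
theorem mk_shift_coboundary_eq_one (c : R.mu)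
    (hc : CycEnvelope.shift (CycEnvelope.isEnvCocycle_coboundary R.augY R.chi c) ∈ contMulAut R.env) :
    TopOut.mk _ ⟨_, hc⟩ = 1 := by
  refine (QuotientGroup.eq_one_iff _).mpr ?_
  rw [Subgroup.mem_subgroupOf]
  exact ⟨CycEnvelope.inMu R.augY R.chi c, (R.shift_coboundary_eq_conj c).symm⟩

/-- **The extension condition holds for every `x ∈ Π^tp_Ÿ`**: take `ρ :=` the coboundary of `η(x)`
on `Π^tp_Y`; its shift is `μ_N`-conjugation, inner, hence trivially `D_Y`-normalising.
[cite: MochizukiEtTh2009, Prop 2.14(ii) p.49] -/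
theorem gal_extension_of_mem_PiYdd {η : R.PiYdd → R.mu} (hη : η ∈ R.thetaCocycles)
    {x : R.PiX} (hx : x ∈ R.PiYdd) :
    ∃ (ρ : R.PiY → R.mu) (hρ : CycEnvelope.IsEnvCocycle R.augY R.chi ρ)
      (hc : CycEnvelope.shift hρ ∈ contMulAut R.env),
      (∀ g : R.PiYdd, ρ (R.inclYdd g) = η g * (R.chi (R.aug x) (η ⟨x⁻¹ * g * x, by
        simpa [mul_assoc] using R.PiYdd_normal.conj_mem _ g.2 x⁻¹⟩))⁻¹) ∧
      R.DY.map (MulAut.conj (TopOut.mk _ ⟨_, hc⟩)).toMonoidHom = R.DY := by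
  refine ⟨_, CycEnvelope.isEnvCocycle_coboundary R.augY R.chi (η ⟨x, hx⟩),
    R.shift_coboundary_mem_contMulAut _, fun g => (R.galDiff_eq_coboundary_of_mem hη hx g).symm, ?_⟩
  rw [R.mk_shift_coboundary_eq_one]
  exact subgroup_map_conj_eq_self_of_mem R.DY (one_mem _)

/-! ## §3. The extension condition is closed under products and inverses -/

/-- Conjugates inside `Π^tp_Ÿ`: `(xy)⁻¹ g (xy) = y⁻¹ (x⁻¹ g x) y` as elements of `Π^tp_Ÿ`.
[cite: MochizukiEtTh2009, Prop 2.14(ii) p.49] -/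
theorem conjYdd_mul (x y : R.PiX) (g : R.PiYdd) :
    (⟨(x * y)⁻¹ * g * (x * y), by
        simpa [mul_assoc] using R.PiYdd_normal.conj_mem _ g.2 (x * y)⁻¹⟩ : R.PiYdd) =
      ⟨y⁻¹ * ((⟨x⁻¹ * g * x, by
        simpa [mul_assoc] using R.PiYdd_normal.conj_mem _ g.2 x⁻¹⟩ : R.PiYdd) : R.PiX) * y, by
        simpa [mul_assoc] using R.PiYdd_normal.conj_mem _
          ((⟨x⁻¹ * g * x, by simpa [mul_assoc] using R.PiYdd_normal.conj_mem _ g.2 x⁻¹⟩ :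
            R.PiYdd)).2 y⁻¹⟩ := by
  apply Subtype.ext
  change (x * y)⁻¹ * (g : R.PiX) * (x * y) = y⁻¹ * (x⁻¹ * g * x) * y
  group

/-- **Products**: if the Galois difference cocycles of `η` at `x` and at `y` extend (with
bi-continuous `D_Y`-normalising shifts), so does the one at `x·y` — extended by `ρ_x · (x·ρ_y)`.
[cite: MochizukiEtTh2009, Prop 2.14(ii) p.49] -/
theorem gal_extension_mul {η : R.PiYdd → R.mu} {x y : R.PiX}
    (hx : ∃ (ρ : R.PiY → R.mu) (hρ : CycEnvelope.IsEnvCocycle R.augY R.chi ρ)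
      (hc : CycEnvelope.shift hρ ∈ contMulAut R.env),
      (∀ g : R.PiYdd, ρ (R.inclYdd g) = η g * (R.chi (R.aug x) (η ⟨x⁻¹ * g * x, by
        simpa [mul_assoc] using R.PiYdd_normal.conj_mem _ g.2 x⁻¹⟩))⁻¹) ∧
      R.DY.map (MulAut.conj (TopOut.mk _ ⟨_, hc⟩)).toMonoidHom = R.DY)
    (hy : ∃ (ρ : R.PiY → R.mu) (hρ : CycEnvelope.IsEnvCocycle R.augY R.chi ρ)
      (hc : CycEnvelope.shift hρ ∈ contMulAut R.env),
      (∀ g : R.PiYdd, ρ (R.inclYdd g) = η g * (R.chi (R.aug y) (η ⟨y⁻¹ * g * y, by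
        simpa [mul_assoc] using R.PiYdd_normal.conj_mem _ g.2 y⁻¹⟩))⁻¹) ∧
      R.DY.map (MulAut.conj (TopOut.mk _ ⟨_, hc⟩)).toMonoidHom = R.DY) :
    ∃ (ρ : R.PiY → R.mu) (hρ : CycEnvelope.IsEnvCocycle R.augY R.chi ρ)
      (hc : CycEnvelope.shift hρ ∈ contMulAut R.env),
      (∀ g : R.PiYdd, ρ (R.inclYdd g) = η g * (R.chi (R.aug (x * y)) (η ⟨(x * y)⁻¹ * g * (x * y), by
        simpa [mul_assoc] using R.PiYdd_normal.conj_mem _ g.2 (x * y)⁻¹⟩))⁻¹) ∧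
      R.DY.map (MulAut.conj (TopOut.mk _ ⟨_, hc⟩)).toMonoidHom = R.DY := by
  obtain ⟨ρx, hρx, hcx, hx, hDx⟩ := hx
  obtain ⟨ρy, hρy, hcy, hy, hDy⟩ := hy
  have hρy' := R.toThetaEnvData.isEnvCocycle_conjX x hρy
  have hcy' : CycEnvelope.shift hρy' ∈ contMulAut R.env := by
    rw [R.toThetaEnvData.shift_conjX x hρy]
    exact mul_mem (mul_mem (R.toThetaEnvData.conjX_mem_contMulAut x) hcy)
      (inv_mem (R.toThetaEnvData.conjX_mem_contMulAut x))
  have hc : CycEnvelope.shift (hρx.mul hρy') ∈ contMulAut R.env := by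
    rw [CycEnvelope.shift_mul hρx hρy']
    exact mul_mem hcx hcy'
  refine ⟨_, hρx.mul hρy', hc, fun g => ?_, ?_⟩
  · have hyg := hy ⟨x⁻¹ * g * x, by simpa [mul_assoc] using R.PiYdd_normal.conj_mem _ g.2 x⁻¹⟩
    have hincl : R.inclYdd ⟨x⁻¹ * g * x, by simpa [mul_assoc] using R.PiYdd_normal.conj_mem _ g.2 x⁻¹⟩
        = ⟨x⁻¹ * (R.inclYdd g : R.PiX) * x, by
          simpa [mul_assoc] using R.PiY_normal.conj_mem _ (R.inclYdd g).2 x⁻¹⟩ := rfl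
    simp only [Pi.mul_apply]
    rw [← hincl, hyg, hx, R.conjYdd_mul x y g, map_mul (R.chi (R.aug x)),
      map_inv (R.chi (R.aug x)), map_mul R.aug, map_mul R.chi, MulAut.mul_apply, mul_assoc (η g),
      inv_mul_cancel_left]
  · have he : (⟨_, hc⟩ : contMulAut R.env) =
        ⟨_, hcx⟩ * (⟨_, R.toThetaEnvData.conjX_mem_contMulAut x⟩ * ⟨_, hcy⟩ *
          ⟨_, R.toThetaEnvData.conjX_mem_contMulAut x⟩⁻¹) := by
      apply Subtype.ext
      change CycEnvelope.shift (hρx.mul hρy') = _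
      rw [CycEnvelope.shift_mul hρx hρy', R.toThetaEnvData.shift_conjX x hρy]
      rfl
    rw [he, map_mul]
    refine (subgroup_map_conj_mul_inv _ hDx ?_).1
    have hm : TopOut.mk _ ((⟨_, R.toThetaEnvData.conjX_mem_contMulAut x⟩ : contMulAut R.env) *
          ⟨_, hcy⟩ * ⟨_, R.toThetaEnvData.conjX_mem_contMulAut x⟩⁻¹) =
        TopOut.mk _ ⟨_, R.toThetaEnvData.conjX_mem_contMulAut x⟩ * TopOut.mk _ ⟨_, hcy⟩ *
          (TopOut.mk _ ⟨_, R.toThetaEnvData.conjX_mem_contMulAut x⟩)⁻¹ := by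
      rw [map_mul, map_mul, map_inv]
    rw [hm]
    have hxD := R.toThetaEnvData.DY_map_conj_conjX x
    exact (subgroup_map_conj_mul_inv _ (subgroup_map_conj_mul_inv _ hxD hDy).1
      (subgroup_map_conj_mul_inv _ hxD hxD).2).1

/-- **Inverses**: if the Galois difference cocycle of `η` at `x` extends (by `ρ`), so does the one at
`x⁻¹` — extended by `(x⁻¹·ρ)⁻¹`. [cite: MochizukiEtTh2009, Prop 2.14(ii) p.49] -/
theorem gal_extension_inv {η : R.PiYdd → R.mu} {x : R.PiX}
    (hx : ∃ (ρ : R.PiY → R.mu) (hρ : CycEnvelope.IsEnvCocycle R.augY R.chi ρ)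
      (hc : CycEnvelope.shift hρ ∈ contMulAut R.env),
      (∀ g : R.PiYdd, ρ (R.inclYdd g) = η g * (R.chi (R.aug x) (η ⟨x⁻¹ * g * x, by
        simpa [mul_assoc] using R.PiYdd_normal.conj_mem _ g.2 x⁻¹⟩))⁻¹) ∧
      R.DY.map (MulAut.conj (TopOut.mk _ ⟨_, hc⟩)).toMonoidHom = R.DY) :
    ∃ (ρ : R.PiY → R.mu) (hρ : CycEnvelope.IsEnvCocycle R.augY R.chi ρ)
      (hc : CycEnvelope.shift hρ ∈ contMulAut R.env),
      (∀ g : R.PiYdd, ρ (R.inclYdd g) = η g * (R.chi (R.aug x⁻¹) (η ⟨x⁻¹⁻¹ * g * x⁻¹, by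
        simpa [mul_assoc] using R.PiYdd_normal.conj_mem _ g.2 x⁻¹⁻¹⟩))⁻¹) ∧
      R.DY.map (MulAut.conj (TopOut.mk _ ⟨_, hc⟩)).toMonoidHom = R.DY := by
  obtain ⟨ρ, hρ, hcρ, hx, hD⟩ := hx
  have hρ' := R.toThetaEnvData.isEnvCocycle_conjX x⁻¹ hρ
  have hc' : CycEnvelope.shift hρ' ∈ contMulAut R.env := by
    rw [R.toThetaEnvData.shift_conjX x⁻¹ hρ]
    exact mul_mem (mul_mem (R.toThetaEnvData.conjX_mem_contMulAut x⁻¹) hcρ)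
      (inv_mem (R.toThetaEnvData.conjX_mem_contMulAut x⁻¹))
  have hc : CycEnvelope.shift hρ'.inv ∈ contMulAut R.env := by
    rw [← CycEnvelope.shift_inv hρ']
    exact inv_mem hc'
  refine ⟨_, hρ'.inv, hc, fun g => ?_, ?_⟩
  · have hxg := hx ⟨x⁻¹⁻¹ * g * x⁻¹, by simpa [mul_assoc] using R.PiYdd_normal.conj_mem _ g.2 x⁻¹⁻¹⟩
    have hincl : R.inclYdd ⟨x⁻¹⁻¹ * g * x⁻¹, by
          simpa [mul_assoc] using R.PiYdd_normal.conj_mem _ g.2 x⁻¹⁻¹⟩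
        = ⟨x⁻¹⁻¹ * (R.inclYdd g : R.PiX) * x⁻¹, by
          simpa [mul_assoc] using R.PiY_normal.conj_mem _ (R.inclYdd g).2 x⁻¹⁻¹⟩ := rfl
    have hback : (⟨x⁻¹ * ((⟨x⁻¹⁻¹ * g * x⁻¹, by
          simpa [mul_assoc] using R.PiYdd_normal.conj_mem _ g.2 x⁻¹⁻¹⟩ : R.PiYdd) : R.PiX) * x, by
          simp [mul_assoc]⟩ : R.PiYdd) = g := by
      apply Subtype.ext
      change x⁻¹ * (x⁻¹⁻¹ * (g : R.PiX) * x⁻¹) * x = g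
      group
    simp only [Pi.inv_apply]
    rw [← hincl, hxg, hback, map_mul (R.chi (R.aug x⁻¹)), mul_inv_rev]
    congr 1
    rw [map_inv (R.chi (R.aug x⁻¹)), inv_inv, ← MulAut.mul_apply, ← map_mul, ← map_mul,
      inv_mul_cancel, map_one, map_one, MulAut.one_apply]
  · have he : (⟨_, hc⟩ : contMulAut R.env) =
        (⟨_, R.toThetaEnvData.conjX_mem_contMulAut x⁻¹⟩ * ⟨_, hcρ⟩ *
          ⟨_, R.toThetaEnvData.conjX_mem_contMulAut x⁻¹⟩⁻¹)⁻¹ := by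
      apply Subtype.ext
      change CycEnvelope.shift hρ'.inv = _
      rw [← CycEnvelope.shift_inv hρ', R.toThetaEnvData.shift_conjX x⁻¹ hρ]
      rfl
    have hm : TopOut.mk _ ((⟨_, R.toThetaEnvData.conjX_mem_contMulAut x⁻¹⟩ : contMulAut R.env) *
          ⟨_, hcρ⟩ * ⟨_, R.toThetaEnvData.conjX_mem_contMulAut x⁻¹⟩⁻¹)⁻¹ =
        (TopOut.mk _ ⟨_, R.toThetaEnvData.conjX_mem_contMulAut x⁻¹⟩ * TopOut.mk _ ⟨_, hcρ⟩ *
          (TopOut.mk _ ⟨_, R.toThetaEnvData.conjX_mem_contMulAut x⁻¹⟩)⁻¹)⁻¹ := by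
      rw [map_inv, map_mul, map_mul, map_inv]
    rw [he, hm]
    have hxD := R.toThetaEnvData.DY_map_conj_conjX x⁻¹
    exact (subgroup_map_conj_mul_inv _ (subgroup_map_conj_mul_inv _
      (subgroup_map_conj_mul_inv _ hxD hD).1 (subgroup_map_conj_mul_inv _ hxD hxD).2).1 hxD).2

/-! ## §4. `Prop214_ii` from the extension condition on generators of `Π^tp_X / Π^tp_Ÿ` -/

/-- **[EtTh] Prop. 2.14 (ii) from generators**: if the Galois difference cocycles of every theta
cocycle extend (with bi-continuous `D_Y`-normalising shifts) at every element of a subset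
`S ⊆ Π^tp_X` with `⟨S⟩ ⊔ Π^tp_Ÿ = Π^tp_X`, then `Prop214_ii` holds (the condition is a subgroup
condition in `x`, automatic on `Π^tp_Ÿ`). In the situation of [EtTh] (`Π^tp_X/Π^tp_Ÿ ≅ (l·ℤ) × μ₂`,
p.41) two elements suffice. [cite: MochizukiEtTh2009, Prop 2.14(ii) p.49] -/
theorem prop214_ii_of_gal_extension_generators (S : Set R.PiX)
    (hS : Subgroup.closure S ⊔ R.PiYdd = ⊤)
    (h : ∀ (η : R.PiYdd → R.mu) (_ : η ∈ R.thetaCocycles), ∀ x ∈ S,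
      ∃ (ρ : R.PiY → R.mu) (hρ : CycEnvelope.IsEnvCocycle R.augY R.chi ρ)
        (hc : CycEnvelope.shift hρ ∈ contMulAut R.env),
        (∀ g : R.PiYdd, ρ (R.inclYdd g) = η g * (R.chi (R.aug x) (η ⟨x⁻¹ * g * x, by
          simpa [mul_assoc] using R.PiYdd_normal.conj_mem _ g.2 x⁻¹⟩))⁻¹) ∧
        R.DY.map (MulAut.conj (TopOut.mk _ ⟨_, hc⟩)).toMonoidHom = R.DY) :
    R.Prop214_ii := by
  refine R.prop214_ii_of_gal_extension fun η hη x => ?_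
  have hx : x ∈ Subgroup.closure (S ∪ (R.PiYdd : Set R.PiX)) := by
    rw [Subgroup.closure_union, Subgroup.closure_eq, hS]
    exact Subgroup.mem_top x
  induction hx using Subgroup.closure_induction with
  | mem z hz =>
    rcases hz with hz | hz
    · exact h η hη z hz
    · exact R.gal_extension_of_mem_PiYdd hη hz
  | one => exact R.gal_extension_of_mem_PiYdd hη (one_mem _)
  | mul a b _ _ iha ihb => exact R.gal_extension_mul iha ihb
  | inv a _ ih => exact R.gal_extension_inv ih

end RigidData

end Literature.AnabelianGeometry.EtaleTheta
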